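import Literature.AlgebraicGeometry.Resolution.MonomialIdealsRegularParameters
import Literature.AlgebraicGeometry.Resolution.ArithmeticalThreefoldsLocalPolyhedronProofs
import Mathlib.Algebra.Polynomial.Taylor
import Mathlib.Algebra.Polynomial.HasseDeriv
import Mathlib.Tactic.Linarith
import Mathlib.Algebra.BigOperators.Field
import HarnessLib

/-!
# Dissolving a solvable vertex of `Δ_S(h; u; X)` (Cossart–Piltant 2019, Def. 2.3 / Prop. 2.2)

Topic: `Literature/AlgebraicGeometry/Resolution`. PROOF-side companion of
`ArithmeticalThreefoldsLocalPolyhedron.lean` (the polyhedron `Δ_S(h; u; X)`, `δ_α`, `I_α(a)`) and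
`MonomialIdealsRegularParameters.lean` (Prop. 2.1: the expansion sets `𝐒(f)`), in support of the
named fact `CossartPiltant2019Local` (`ArithmeticalThreefoldsLocal.lean`). Source:

* V. Cossart, O. Piltant, *Resolution of singularities of arithmetical threefolds*, J. Algebra
  529 (2019) 268–535 = arXiv:1412.0868 (v1), Def. 2.2 (initial forms `in_α h`), Def. 2.3
  (solvable vertices: `in_x h = (X - λ̄ U^x)^m`, i.e. `γ̄(f_{i,X}, i x) = (-1)^i C(m,i) λ̄^i`),
  Prop. 2.2 (Hironaka: the polyhedron is minimal iff it has no solvable vertex) and Def. 2.4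
  (v1 pp. 10–11); H. Hironaka, *Characteristic polyhedra of singularities*, J. Math. Kyoto
  Univ. 7 (1967), (3.10) "vertex preparation" ([H3] of the paper).

We PROVE the computation behind the "only if" half of Prop. 2.2 — *a solvable vertex can be
dissolved by the translation `X' := X - λ u^x`* — in the language of the tree (weights
`|·|_α = weight α`, monomials `uPow`, the filtration `I_α(a) = monomialIdeal u α a`, "`δ_α ≥ q`" =
`DeltaGE`, and `Δ_S(h; u; X) = charPolyhedron u h` rendered by its support function):

* `taylor_coeff_mem_span_uPow_of_solvable` — if `x ∈ ℕ^N` is the vertex of `Δ_S(h; u; X)`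
  exposed by a weight vector `α > 0` (every exponent `a` of an expansion of `f_{k,X}` other than
  `k x` has `|a|_α > k |x|_α`) and is solvable with parameter `λ` (the coefficient of `u^{kx}`
  in `f_{k,X}` is `≡ C(m,k) (-λ)^k (mod (u))`), then every coefficient `f_{i,X'}` of
  `h(X' + λ u^x)` lies in the monomial ideal `(u^b : |b|_α > i |x|_α)`: the formula (2.2)
  `f_{i,X'} = Σ_j C(m-j, i-j) f_{j,X} (λu^x)^{i-j}` and the binomial identity
  `Σ_j C(m-j, i-j) C(m, j) (-1)^j = C(m, i) Σ_j (-1)^j C(i, j) = 0`;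
* `exists_gt_deltaGE_taylor_of_solvable` — hence `δ_α(h; u; X') > |x|_α = δ_α(h; u; X)`;
* `not_mem_charPolyhedron_taylor_of_solvable` — so `x ∉ Δ_S(h; u; X')`, while
* `charPolyhedron_taylor_subset` — `Δ_S(h; u; X - θ) ⊆ Δ_S(h; u; X)` for any `θ = λ u^x` with
  `x ∈ Δ_S(h; u; X)` (from `DeltaGE.taylor`), and
* `smul_mem_charPolyhedron_of_minimal` — the generating points `a / i`, `a ∈ 𝐒(f_{i,X})`, of
  Def. 2.1 lie in `Δ_S(h; u; X)` (one half of the identification of Def. 2.1 with the tree's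
  support-function rendering).

Everything is PROVED; no definitions and no named facts are introduced.
-/

open Finset Polynomial IsLocalRing

namespace Literature.AlgebraicGeometry.Resolution.CossartPiltant

universe u

variable {S : Type u} [CommRing S] {N : ℕ}

/-! ## Small monomial / weight identities -/

/-- `u^{k x} = (u^x)^k`. [folklore] -/
theorem uPow_nsmul (u : Fin N → S) (k : ℕ) (x : Fin N → ℕ) : uPow u (k • x) = uPow u x ^ k := by
  induction k with
  | zero => rw [zero_smul, uPow_zero, pow_zero]
  | succ k ih => rw [succ_nsmul, uPow_add, ih, pow_succ]

/-- `|k x|_α = k |x|_α`. [folklore] -/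
theorem weight_nsmul (α : Fin N → ℝ) (k : ℕ) (x : Fin N → ℕ) :
    weight α (k • x) = (k : ℝ) * weight α x := by
  unfold weight
  rw [Finset.mul_sum]
  refine Finset.sum_congr rfl fun j _ => ?_
  simp only [Pi.smul_apply, smul_eq_mul, Nat.cast_mul]
  ring

/-- The binomial identity behind vertex dissolution:
`C(j + (m - i), m - i) · C(m, i - j) = C(m, i) · C(i, j)` for `j ≤ i ≤ m`. [folklore] -/
theorem choose_mul_choose_eq {m i j : ℕ} (hj : j ≤ i) (hi : i ≤ m) :
    (j + (m - i)).choose (m - i) * m.choose (i - j) = m.choose i * i.choose j := by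
  -- `m.choose i * i.choose (i - j) = m.choose (i - j) * (m - (i - j)).choose (i - (i - j))`
  have h1 := Nat.choose_mul (n := m) (Nat.sub_le i j)
  rw [Nat.choose_symm hj, show i - (i - j) = j by omega, show m - (i - j) = j + (m - i) by omega]
    at h1
  rw [h1, mul_comm, Nat.choose_symm_add]

/-- `Σ_{j ≤ i} C(j + (m - i), m - i) C(m, i - j) (-λ)^{i-j} λ^j = C(m, i) (λ - λ)^i = 0` for
`1 ≤ i ≤ m`. [folklore] -/
theorem sum_choose_mul_neg_pow_mul_pow_eq_zero {m i : ℕ} (hi1 : 1 ≤ i) (him : i ≤ m) (lam : S) :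
    ∑ j ∈ range (i + 1), ((j + (m - i)).choose (m - i) : S) *
      ((m.choose (i - j) : S) * (-lam) ^ (i - j)) * lam ^ j = 0 := by
  have hbin : (lam + -lam) ^ i = ∑ j ∈ range (i + 1), lam ^ j * (-lam) ^ (i - j) * (i.choose j : S) :=
    add_pow lam (-lam) i
  rw [add_neg_cancel, zero_pow (by omega)] at hbin
  have : ∑ j ∈ range (i + 1), ((j + (m - i)).choose (m - i) : S) *
      ((m.choose (i - j) : S) * (-lam) ^ (i - j)) * lam ^ j =
      (m.choose i : S) * ∑ j ∈ range (i + 1), lam ^ j * (-lam) ^ (i - j) * (i.choose j : S) := by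
    rw [Finset.mul_sum]
    refine Finset.sum_congr rfl fun j hj => ?_
    have hji : j ≤ i := Nat.lt_succ_iff.mp (Finset.mem_range.mp hj)
    have hnat : ((j + (m - i)).choose (m - i) : S) * (m.choose (i - j) : S) =
        (m.choose i : S) * (i.choose j : S) := by
      rw [← Nat.cast_mul, ← Nat.cast_mul, choose_mul_choose_eq hji him]
    calc ((j + (m - i)).choose (m - i) : S) * ((m.choose (i - j) : S) * (-lam) ^ (i - j)) * lam ^ j
        = (((j + (m - i)).choose (m - i) : S) * (m.choose (i - j) : S)) *
            ((-lam) ^ (i - j) * lam ^ j) := by ring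
      _ = ((m.choose i : S) * (i.choose j : S)) * ((-lam) ^ (i - j) * lam ^ j) := by rw [hnat]
      _ = (m.choose i : S) * (lam ^ j * (-lam) ^ (i - j) * (i.choose j : S)) := by ring
  rw [this, ← hbin, mul_zero]

/-! ## Dissolution of a solvable vertex -/

/-- **Vertex dissolution** (the computation behind Prop. 2.2, "only if"; Hironaka's vertex
preparation).  Let `h ∈ S[X]` be monic of degree `m`, `f_{k,X} = coeff_{m-k} h` expanded as
`f_{k,X} = Σ_{a ∈ A k} γ_k(a) u^a` (`1 ≤ k ≤ m`).  Suppose `x ∈ ℕ^N` is *exposed* by the weight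
vector `α > 0` — `|a|_α > k |x|_α` for every `a ∈ A k` other than `k x` — and *solvable* with
parameter `λ ∈ S` — `γ_k(kx) ≡ C(m,k) (-λ)^k (mod (u))` (reading `γ_k(kx) = 0` if `kx ∉ A k`),
i.e. `in_x h = (X - λ̄ U^x)^m` (Def. 2.3).  Then after the translation `X' := X - λ u^x` every
coefficient `f_{i,X'}` (`1 ≤ i ≤ m`) lies in the monomial ideal `(u^b : |b|_α > i |x|_α)`.
[cite: CossartPiltant2019, Def. 2.3 and Prop. 2.2 (arXiv v1 p. 11)] -/
theorem taylor_coeff_mem_span_uPow_of_solvable (u : Fin N → S) {α : Fin N → ℝ}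
    (hα : ∀ j, 0 < α j) {h : S[X]} (hh : h.Monic) (x : Fin N → ℕ) (lam : S)
    (A : ℕ → Finset (Fin N → ℕ)) (γ : ℕ → (Fin N → ℕ) → S)
    (hexpand : ∀ k ∈ Finset.Icc 1 h.natDegree,
      h.coeff (h.natDegree - k) = ∑ a ∈ A k, γ k a * uPow u a)
    (hexpose : ∀ k ∈ Finset.Icc 1 h.natDegree, ∀ a ∈ A k, a ≠ k • x →
      (k : ℝ) * weight α x < weight α a)
    (hsolv : ∀ k ∈ Finset.Icc 1 h.natDegree,
      (if k • x ∈ A k then γ k (k • x) else 0) - (h.natDegree.choose k : S) * (-lam) ^ k ∈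
        Ideal.span (Set.range u))
    {i : ℕ} (hi : i ∈ Finset.Icc 1 h.natDegree) :
    (taylor (lam * uPow u x) h).coeff (h.natDegree - i) ∈
      Ideal.span (uPow u '' {b | (i : ℝ) * weight α x < weight α b}) := by
  classical
  obtain ⟨hi1, him⟩ := Finset.mem_Icc.mp hi
  set m := h.natDegree with hm
  set Ip : Ideal S := Ideal.span (uPow u '' {b | (i : ℝ) * weight α x < weight α b}) with hIp
  set θ := lam * uPow u x with hθ
  -- the diagonal coefficients `c_k = γ_k(kx)` (`c_0 = 1`)
  set c : ℕ → S := fun k => if k = 0 then 1 else (if k • x ∈ A k then γ k (k • x) else 0) with hc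
  -- Step 1: the coefficient formula (2.2)
  have hdeg : (hasseDeriv (m - i) h).natDegree < i + 1 :=
    lt_of_le_of_lt (natDegree_hasseDeriv_le h (m - i)) (by omega)
  have hform : (taylor θ h).coeff (m - i) =
      ∑ j ∈ range (i + 1), ((j + (m - i)).choose (m - i) : S) * h.coeff (j + (m - i)) * θ ^ j := by
    rw [taylor_coeff, eval_eq_sum_range' hdeg]
    refine Finset.sum_congr rfl fun j _ => ?_
    rw [hasseDeriv_coeff]
  have hθj : ∀ j : ℕ, θ ^ j = lam ^ j * uPow u (j • x) := fun j => by
    rw [hθ, mul_pow, uPow_nsmul]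
  -- Step 2: each term is `≡ C_j c_{i-j} λ^j u^{ix}` modulo `Ip`
  have hterm : ∀ j ∈ range (i + 1),
      ((j + (m - i)).choose (m - i) : S) * h.coeff (j + (m - i)) * θ ^ j -
        ((j + (m - i)).choose (m - i) : S) * c (i - j) * lam ^ j * uPow u (i • x) ∈ Ip := by
    intro j hj
    have hji : j ≤ i := Nat.lt_succ_iff.mp (Finset.mem_range.mp hj)
    rcases hji.lt_or_eq with hlt | rfl
    · -- `j < i`: expand `f_{i-j,X}`
      have hk : i - j ∈ Finset.Icc 1 m := Finset.mem_Icc.mpr ⟨by omega, by omega⟩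
      have hcoef : h.coeff (j + (m - i)) = ∑ a ∈ A (i - j), γ (i - j) a * uPow u a := by
        rw [← hexpand _ hk]
        congr 1
        omega
      have hcij : c (i - j) = if (i - j) • x ∈ A (i - j) then γ (i - j) ((i - j) • x) else 0 := by
        simp [hc, show i - j ≠ 0 by omega]
      -- the sum over `a ≠ (i-j) x` is what remains
      have hsplit : (∑ a ∈ A (i - j), γ (i - j) a * uPow u a) * uPow u (j • x) -
          c (i - j) * uPow u (i • x) =
          ∑ a ∈ (A (i - j)).filter (fun a => a ≠ (i - j) • x),
            γ (i - j) a * uPow u (a + j • x) := by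
        rw [hcij, Finset.sum_mul,
          ← Finset.sum_filter_add_sum_filter_not (A (i - j)) (fun a => a ≠ (i - j) • x)]
        have hdiag : ∑ a ∈ (A (i - j)).filter (fun a => ¬ a ≠ (i - j) • x),
            γ (i - j) a * uPow u a * uPow u (j • x) =
            (if (i - j) • x ∈ A (i - j) then γ (i - j) ((i - j) • x) else 0) * uPow u (i • x) := by
          have hfilt : (A (i - j)).filter (fun a => ¬ a ≠ (i - j) • x) =
              (A (i - j)).filter (fun a => a = (i - j) • x) := by
            refine Finset.filter_congr fun a _ => ?_
            push Not
            rfl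
          rw [hfilt, Finset.filter_eq']
          split_ifs with hmem
          · rw [Finset.sum_singleton, mul_assoc, ← uPow_add]
            congr 2
            rw [← add_smul, Nat.sub_add_cancel hji]
          · rw [Finset.sum_empty, zero_mul]
        rw [hdiag, add_sub_cancel_right]
        refine Finset.sum_congr rfl fun a _ => ?_
        rw [mul_assoc, ← uPow_add]
      have hmemI : (∑ a ∈ A (i - j), γ (i - j) a * uPow u a) * uPow u (j • x) -
          c (i - j) * uPow u (i • x) ∈ Ip := by
        rw [hsplit]
        refine Submodule.sum_mem _ fun a ha => Ideal.mul_mem_left _ _ (uPow_mem_span_uPow u ?_)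
        obtain ⟨haA, hne⟩ := Finset.mem_filter.mp ha
        show (i : ℝ) * weight α x < weight α (a + j • x)
        have h1 := hexpose (i - j) hk a haA hne
        rw [weight_add, weight_nsmul]
        have : ((i - j : ℕ) : ℝ) = (i : ℝ) - (j : ℝ) := by
          rw [Nat.cast_sub hji]
        rw [this] at h1
        linarith
      have : ((j + (m - i)).choose (m - i) : S) * h.coeff (j + (m - i)) * θ ^ j -
          ((j + (m - i)).choose (m - i) : S) * c (i - j) * lam ^ j * uPow u (i • x) =
          (((j + (m - i)).choose (m - i) : S) * lam ^ j) *
            ((∑ a ∈ A (i - j), γ (i - j) a * uPow u a) * uPow u (j • x) -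
              c (i - j) * uPow u (i • x)) := by
        rw [hcoef, hθj]
        ring
      rw [this]
      exact Ideal.mul_mem_left _ _ hmemI
    · -- `j = i`: the leading coefficient `1` and `c_0 = 1`
      have hlead : h.coeff (j + (m - j)) = 1 := by
        rw [show j + (m - j) = m by omega]
        exact hh
      have hc0 : c (j - j) = 1 := by simp [hc]
      rw [hlead, hc0, hθj, sub_eq_zero.mpr (by ring)]
      exact Ideal.zero_mem _
  -- Step 3: `f_{i,X'} - (Σ_j C_j c_{i-j} λ^j) u^{ix} ∈ Ip`
  have hsum : (taylor θ h).coeff (m - i) -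
      (∑ j ∈ range (i + 1), ((j + (m - i)).choose (m - i) : S) * c (i - j) * lam ^ j) *
        uPow u (i • x) ∈ Ip := by
    rw [hform, Finset.sum_mul, ← Finset.sum_sub_distrib]
    exact Submodule.sum_mem _ fun j hj => hterm j hj
  -- Step 4: the bracket lies in `(u)` by solvability and the binomial identity
  have hbr : ∑ j ∈ range (i + 1), ((j + (m - i)).choose (m - i) : S) * c (i - j) * lam ^ j ∈
      Ideal.span (Set.range u) := by
    have hzero := sum_choose_mul_neg_pow_mul_pow_eq_zero (S := S) hi1 him lam
    rw [← sub_zero (∑ j ∈ range (i + 1), ((j + (m - i)).choose (m - i) : S) * c (i - j) * lam ^ j),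
      ← hzero, ← Finset.sum_sub_distrib]
    refine Submodule.sum_mem _ fun j hj => ?_
    have hji : j ≤ i := Nat.lt_succ_iff.mp (Finset.mem_range.mp hj)
    have : ((j + (m - i)).choose (m - i) : S) * c (i - j) * lam ^ j -
        ((j + (m - i)).choose (m - i) : S) * ((m.choose (i - j) : S) * (-lam) ^ (i - j)) * lam ^ j =
        (((j + (m - i)).choose (m - i) : S) * lam ^ j) *
          (c (i - j) - (m.choose (i - j) : S) * (-lam) ^ (i - j)) := by ring
    rw [this]
    refine Ideal.mul_mem_left _ _ ?_
    by_cases hij : i - j = 0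
    · rw [hij]
      simp [hc]
    · have hk : i - j ∈ Finset.Icc 1 m := Finset.mem_Icc.mpr ⟨by omega, by omega⟩
      have := hsolv (i - j) hk
      simpa [hc, hij] using this
  -- Step 5: `(u) · u^{ix} ⊆ Ip` because `α > 0`
  have hdiag : (∑ j ∈ range (i + 1), ((j + (m - i)).choose (m - i) : S) * c (i - j) * lam ^ j) *
      uPow u (i • x) ∈ Ip := by
    obtain ⟨d, hd⟩ := Ideal.mem_span_range_iff_exists_fun.mp hbr
    rw [← hd, Finset.sum_mul]
    refine Submodule.sum_mem _ fun l _ => ?_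
    rw [mul_assoc, ← uPow_single u l, ← uPow_add]
    refine Ideal.mul_mem_left _ _ (uPow_mem_span_uPow u ?_)
    show (i : ℝ) * weight α x < weight α (Pi.single l 1 + i • x)
    rw [weight_add, weight_single, weight_nsmul]
    linarith [hα l]
  have := add_mem hsum hdiag
  rwa [sub_add_cancel] at this

/-- A member of a "strict" monomial ideal `(u^b : |b|_α > c)` lies in `I_α(c')` for some
`c' > c` (finitely many generators are involved). [folklore] -/
theorem exists_lt_mem_monomialIdeal_of_mem_span_lt (u : Fin N → S) (α : Fin N → ℝ) {c : ℝ}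
    {f : S} (hf : f ∈ Ideal.span (uPow u '' {b | c < weight α b})) :
    ∃ c' : ℝ, c < c' ∧ f ∈ monomialIdeal u α c' := by
  classical
  obtain ⟨T, hT, hfT⟩ := Submodule.mem_span_finite_of_mem_span hf
  obtain ⟨s, hs, rfl⟩ := Finset.subset_set_image_iff.mp hT
  by_cases hne : s.Nonempty
  · refine ⟨s.inf' hne (weight α), (Finset.lt_inf'_iff hne).mpr fun b hb => hs (Finset.mem_coe.mpr hb), ?_⟩
    refine (Ideal.span_le.mpr ?_) hfT
    intro t ht
    obtain ⟨b, hb, rfl⟩ := Finset.mem_image.mp (Finset.mem_coe.mp ht)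
    exact uPow_mem_monomialIdeal u (Finset.inf'_le _ hb)
  · rw [Finset.not_nonempty_iff_eq_empty.mp hne, Finset.image_empty, Finset.coe_empty,
      Submodule.span_empty, Submodule.mem_bot] at hfT
    exact ⟨c + 1, lt_add_one c, hfT ▸ Ideal.zero_mem _⟩

/-- **After dissolving a solvable vertex exposed by `α`, `δ_α(h; u; X') > |x|_α`.**
[cite: CossartPiltant2019, Prop. 2.2 (arXiv v1 p. 11)] -/
theorem exists_gt_deltaGE_taylor_of_solvable (u : Fin N → S) {α : Fin N → ℝ}
    (hα : ∀ j, 0 < α j) {h : S[X]} (hh : h.Monic) (x : Fin N → ℕ) (lam : S)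
    (A : ℕ → Finset (Fin N → ℕ)) (γ : ℕ → (Fin N → ℕ) → S)
    (hexpand : ∀ k ∈ Finset.Icc 1 h.natDegree,
      h.coeff (h.natDegree - k) = ∑ a ∈ A k, γ k a * uPow u a)
    (hexpose : ∀ k ∈ Finset.Icc 1 h.natDegree, ∀ a ∈ A k, a ≠ k • x →
      (k : ℝ) * weight α x < weight α a)
    (hsolv : ∀ k ∈ Finset.Icc 1 h.natDegree,
      (if k • x ∈ A k then γ k (k • x) else 0) - (h.natDegree.choose k : S) * (-lam) ^ k ∈
        Ideal.span (Set.range u)) :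
    ∃ q : ℝ, weight α x < q ∧ DeltaGE u α (taylor (lam * uPow u x) h) q := by
  classical
  -- a margin `q_i > |x|_α` for each `i`, then the minimum
  have hmarg : ∀ i ∈ Finset.Icc 1 h.natDegree, ∃ q : ℝ, weight α x < q ∧
      (taylor (lam * uPow u x) h).coeff (h.natDegree - i) ∈ monomialIdeal u α (i * q) := by
    intro i hi
    obtain ⟨c', hc', hmem⟩ := exists_lt_mem_monomialIdeal_of_mem_span_lt u α
      (taylor_coeff_mem_span_uPow_of_solvable u hα hh x lam A γ hexpand hexpose hsolv hi)
    have hipos : (0 : ℝ) < i := by exact_mod_cast (Finset.mem_Icc.mp hi).1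
    refine ⟨c' / i, ?_, ?_⟩
    · rw [lt_div_iff₀ hipos, mul_comm]
      exact hc'
    · rwa [mul_div_cancel₀ _ hipos.ne']
  choose! qf hqf using hmarg
  by_cases hm : h.natDegree = 0
  · refine ⟨weight α x + 1, lt_add_one _, fun i hi => ?_⟩
    exfalso
    rw [natDegree_taylor, hm] at hi
    have := Finset.mem_Icc.mp hi
    omega
  have hne : (Finset.Icc 1 h.natDegree).Nonempty := ⟨1, Finset.mem_Icc.mpr ⟨le_rfl, by omega⟩⟩
  refine ⟨(Finset.Icc 1 h.natDegree).inf' hne qf,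
    (Finset.lt_inf'_iff hne).mpr fun i hi => (hqf i hi).1, fun i hi => ?_⟩
  rw [natDegree_taylor] at hi ⊢
  refine monomialIdeal_antitone u α ?_ (hqf i hi).2
  have hipos : (0 : ℝ) ≤ i := by exact_mod_cast (Nat.zero_le i)
  exact mul_le_mul_of_nonneg_left (Finset.inf'_le _ hi) hipos

/-- **… hence `x ∉ Δ_S(h; u; X')`**: the solvable vertex has been dissolved.
[cite: CossartPiltant2019, Prop. 2.2 (arXiv v1 p. 11)] -/
theorem not_mem_charPolyhedron_taylor_of_solvable (u : Fin N → S) {α : Fin N → ℝ}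
    (hα : ∀ j, 0 < α j) {h : S[X]} (hh : h.Monic) (x : Fin N → ℕ) (lam : S)
    (A : ℕ → Finset (Fin N → ℕ)) (γ : ℕ → (Fin N → ℕ) → S)
    (hexpand : ∀ k ∈ Finset.Icc 1 h.natDegree,
      h.coeff (h.natDegree - k) = ∑ a ∈ A k, γ k a * uPow u a)
    (hexpose : ∀ k ∈ Finset.Icc 1 h.natDegree, ∀ a ∈ A k, a ≠ k • x →
      (k : ℝ) * weight α x < weight α a)
    (hsolv : ∀ k ∈ Finset.Icc 1 h.natDegree,
      (if k • x ∈ A k then γ k (k • x) else 0) - (h.natDegree.choose k : S) * (-lam) ^ k ∈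
        Ideal.span (Set.range u)) :
    (fun j => (x j : ℝ)) ∉ charPolyhedron u (taylor (lam * uPow u x) h) := by
  obtain ⟨q, hq, hD⟩ := exists_gt_deltaGE_taylor_of_solvable u hα hh x lam A γ hexpand hexpose hsolv
  rintro ⟨-, hx⟩
  have := hx α hα q hD
  unfold weight at hq
  linarith

/-- **Translations along points of the polyhedron do not enlarge it**:
`Δ_S(h; u; X - λu^x) ⊆ Δ_S(h; u; X)` whenever `x ∈ Δ_S(h; u; X) ∩ ℕ^N` (`h` monic).
[cite: CossartPiltant2019, Prop. 2.2 (arXiv v1 p. 11)] -/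
theorem charPolyhedron_taylor_subset (u : Fin N → S) {h : S[X]} (hh : h.Monic)
    {x : Fin N → ℕ} (hx : (fun j => (x j : ℝ)) ∈ charPolyhedron u h) (lam : S) :
    charPolyhedron u (taylor (lam * uPow u x) h) ⊆ charPolyhedron u h := by
  rintro y ⟨hy0, hy⟩
  refine ⟨hy0, fun β hβ q hq => hy β hβ q ?_⟩
  refine DeltaGE.taylor hh (Ideal.mul_mem_left _ _ ?_) hq
  refine monomialIdeal_antitone u β (hx.2 β hβ q hq) (uPow_mem_monomialIdeal u ?_)
  unfold weight
  rfl

/-- **The generating points of Def. 2.1 lie in the polyhedron**: for `a ∈ 𝐒(f_{i,X})` (the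
minimal antichain of Prop. 2.1), `a / i ∈ Δ_S(h; u; X)`.
[cite: CossartPiltant2019, Def. 2.1 (arXiv v1 p. 10)] -/
theorem smul_mem_charPolyhedron_of_minimal (u : Fin N → S) {h : S[X]} {i : ℕ}
    (hi : i ∈ Finset.Icc 1 h.natDegree) {A : Finset (Fin N → ℕ)}
    (hmin : ∀ B : Set (Fin N → ℕ), h.coeff (h.natDegree - i) ∈ Ideal.span (uPow u '' B) →
      ∀ a ∈ A, ∃ b ∈ B, b ≤ a)
    {a : Fin N → ℕ} (ha : a ∈ A) :
    (fun j => (a j : ℝ) / i) ∈ charPolyhedron u h := by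
  have hipos : (0 : ℝ) < i := by exact_mod_cast (Finset.mem_Icc.mp hi).1
  refine ⟨fun j => div_nonneg (Nat.cast_nonneg _) hipos.le, fun β hβ q hq => ?_⟩
  have hmem := hq i hi
  rw [monomialIdeal_eq_span_image] at hmem
  obtain ⟨b, hb, hba⟩ := hmin _ hmem a ha
  have hb' : (i : ℝ) * q ≤ weight β b := hb
  have hle : weight β b ≤ weight β a := weight_mono (fun j => (hβ j).le) hba
  have : ∑ j, β j * ((a j : ℝ) / i) = weight β a / i := by
    unfold weight
    rw [Finset.sum_div]
    refine Finset.sum_congr rfl fun j _ => ?_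
    ring
  rw [this, le_div_iff₀ hipos, mul_comm]
  exact hb'.trans hle

end Literature.AlgebraicGeometry.Resolution.CossartPiltant
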